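import Summits.AnomalousDissipation.AnomalousDissipation.Theorems.RestMeanFloorTG.Negative.LaminarLineUnique
import Literature.Analysis.FluidPDE.StokesTorusConvectionMode
import Literature.Analysis.FluidPDE.StokesTorusGalerkinDimProofs
import Literature.Analysis.FluidPDE.EnergySpaceTorusHilbertBasisProofs
import Literature.Analysis.FluidPDE.StatisticalSolutionProofs
import Literature.Analysis.FluidPDE.CheskidovGluedCalculus
import Literature.Analysis.FunctionSpaces.TorusFourierConvolution

/-!
# Every laminar line of every single-Stokes-mode force on `T³` is rigid (negative lane of `RestMeanFloorTG`, 24255)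

Negative-lane proof file (theorems only; no `sorry`; no Theses statement asserted positively).
`LaminarLineUnique` treated the vertical Kolmogorov shears `shear n b`; here the SAME mechanism
(an explicit classical laminar solution + forced weak–strong uniqueness on `T³`,
`Torus.IsGlobalLerayHopf.ae_eq_of_isClassicalNSSolutionOn_univ_forced`) is run for an ARBITRARY single
Stokes mode `F = stokesMode k v c` (`k ≠ 0`, `⟪k, v⟫ = 0`, cosine or sine) — in particular for the
Kolmogorov force `stokesMode (0,2,0) e₀ sin = sin(4πx₁)e₀` of `SymmetricOrLoud` / `ClassTrim` /
`CoherentFraction` / `SteadyCoherentFraction`. With `λ = stokesEigenvalue k = 4π²|k|²` and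
`A = (λν)⁻¹` the laminar flow from the datum `a₀ • F` is `(A + (a₀ − A)e^{−λνt}) • F`, and:
`isClassicalNSSolutionOn_ampMode` (`t ↦ a(t) • F` is classical with force `(a' + λν a) • F`, zero
pressure: the self-advection of a transversal single mode vanishes); `ae_eq_laminar_of_isGlobalLerayHopf_mode`
(every global Leray–Hopf solution with force `F` and datum `a₀ • F` is that laminar flow a.e. at every
`t > 0`); `le_meanEnergy_of_isGlobalLerayHopf_mode` (`⟨‖u‖²⟩ ≥ ‖v‖²/(16λ²ν²)`, uniformly in `a₀`);
`not_boundedEnergy_family_mode`, `not_zerothLaw_shape_mode(_rest)` (the summit's shape — bounded mean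
energy and a dissipation floor along `ν_j → 0` — is FALSE with the force pinned to any single Stokes
mode and the data pinned anywhere on its laminar line, for every admissible choice of solutions).
-/

noncomputable section
-- the mandated namespace `Summit.<Summit>.<Problem>.Theorems` repeats `AnomalousDissipation` (single-problem summit)
set_option linter.dupNamespace false

namespace Summit.AnomalousDissipation.AnomalousDissipation.Theorems.RestMeanFloorTG.Negative

open MeasureTheory Set Filter Topology UnitAddTorus
open scoped ENNReal NNReal InnerProductSpace ContDiff
open Literature.Analysis.FunctionSpaces Literature.Analysis.FunctionSpaces.Torus
open Literature.Analysis.FluidPDE Literature.Analysis.FluidPDE.Torus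

variable {k : Fin 3 → ℤ} {v : EuclideanSpace ℝ (Fin 3)}

/-! ## 1. Amplitude-modulated single modes `t ↦ a(t) • stokesMode k v c` are classical solutions -/

/-- `(t, x) ↦ a(t) • F(x)` is jointly smooth for smooth `a`. [folklore] -/
theorem isSmoothSpaceTimeOn_ampMode (k : Fin 3 → ℤ) (v : EuclideanSpace ℝ (Fin 3)) (c : Bool)
    (a : ℝ → ℝ) (ha : ContDiff ℝ ∞ a) :
    Literature.Analysis.FunctionSpaces.Torus.IsSmoothSpaceTimeOn univ
      (fun t (x : UnitAddTorus (Fin 3)) => a t • stokesMode k v c x) := by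
  have h1 : Literature.Analysis.FunctionSpaces.Torus.IsSmoothSpaceTimeOn univ
      (fun t (_ : UnitAddTorus (Fin 3)) => a t) := by
    unfold Literature.Analysis.FunctionSpaces.Torus.IsSmoothSpaceTimeOn
    have : stLift (fun t (_ : UnitAddTorus (Fin 3)) => a t) = a ∘ Prod.fst := by
      funext p
      rfl
    rw [this]
    exact (ha.comp contDiff_fst).contDiffOn
  exact h1.smul (isSmoothSpaceTimeOn_const (isSmooth_stokesMode k v c) _)

/-- `∂ₜ(a(t) • F(x)) = a'(t) • F(x)`. [folklore] -/
theorem timeDerivWithin_ampMode (k : Fin 3 → ℤ) (v : EuclideanSpace ℝ (Fin 3)) (c : Bool)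
    {a : ℝ → ℝ} (ha : ContDiff ℝ ∞ a) (t : ℝ) (x : UnitAddTorus (Fin 3)) :
    Literature.Analysis.FunctionSpaces.Torus.timeDerivWithin univ
      (fun t (x : UnitAddTorus (Fin 3)) => a t • stokesMode k v c x) t x = deriv a t • stokesMode k v c x := by
  unfold Literature.Analysis.FunctionSpaces.Torus.timeDerivWithin
  rw [derivWithin_univ]
  exact deriv_smul_const ((ha.differentiable (by simp)).differentiableAt) _

/-- The self-advection of a transversal single mode vanishes: `((aF)·∇)(aF) = 0` (`⟪k, F(x)⟫ = 0`). [folklore] -/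
theorem convect_ampMode_self (hkv : ⟪latticeVec k, v⟫_ℝ = 0) (c : Bool) (r : ℝ) (x : UnitAddTorus (Fin 3)) :
    Torus.convect (fun y => r • stokesMode k v c y) (fun y => r • stokesMode k v c y) x = 0 := by
  rw [Gluing.convect_smul_smul ((isSmooth_stokesMode k v c).isContDiff (by simp)), convect_stokesMode_apply,
    stokesMode_apply, inner_smul_right, hkv, mul_zero, zero_smul, smul_zero]

/-- `Δ(r • F) = −λ r • F`, `λ = stokesEigenvalue k`. [folklore] -/
theorem laplacian_ampMode (k : Fin 3 → ℤ) (v : EuclideanSpace ℝ (Fin 3)) (c : Bool) (r : ℝ)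
    (x : UnitAddTorus (Fin 3)) :
    Torus.laplacian (fun y => r • stokesMode k v c y) x = (-(stokesEigenvalue k * r)) • stokesMode k v c x := by
  have h : (fun y => r • stokesMode k v c y) = r • ⇑(stokesMode k v c) := rfl
  rw [h, laplacian_const_smul_apply (isSmooth_stokesMode k v c), laplacian_stokesMode, smul_smul]
  ring_nf

/-- `r • F` is divergence free (`⟪k, v⟫ = 0`). [folklore] -/
theorem isDivFree_ampMode (hkv : ⟪latticeVec k, v⟫_ℝ = 0) (c : Bool) (r : ℝ) :
    Torus.IsDivFree (fun y : UnitAddTorus (Fin 3) => r • stokesMode k v c y) := by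
  have h : (fun y : UnitAddTorus (Fin 3) => r • stokesMode k v c y) = ⇑(stokesMode k (r • v) c) := by
    funext y
    rw [stokesMode_smul, ContinuousMap.smul_apply]
  rw [h]
  exact isDivFree_stokesMode (by rw [inner_smul_right, hkv, mul_zero]) c

/-- **Amplitude-modulated transversal single modes are classical NS solutions** on `ℝ × T³`:
viscosity `ν`, zero pressure, force `(a' + λν a) • F`. [folklore] -/
theorem isClassicalNSSolutionOn_ampMode (hkv : ⟪latticeVec k, v⟫_ℝ = 0) (c : Bool) (a : ℝ → ℝ)
    (ha : ContDiff ℝ ∞ a) (ν : ℝ) :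
    IsClassicalNSSolutionOn univ ν
      (fun t (x : UnitAddTorus (Fin 3)) => (deriv a t + stokesEigenvalue k * ν * a t) • stokesMode k v c x)
      (fun t (x : UnitAddTorus (Fin 3)) => a t • stokesMode k v c x)
      (fun _ _ => (0 : ℝ)) where
  smooth_velocity := isSmoothSpaceTimeOn_ampMode k v c a ha
  smooth_pressure := isSmoothSpaceTimeOn_const (isSmooth_const (0 : ℝ)) _
  divFree t _ := isDivFree_ampMode hkv c (a t)
  momentum t _ x := by
    have hg : Torus.gradient (fun _ : UnitAddTorus (Fin 3) => (0 : ℝ)) x = 0 :=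
      gradient_fun_const (0 : EuclideanSpace ℝ (Fin 3)) (0 : ℝ)
    rw [timeDerivWithin_ampMode k v c ha, convect_ampMode_self hkv, laplacian_ampMode, add_zero, hg, sub_zero,
      smul_smul, ← add_smul]
    congr 1
    ring

/-! ## 2. Uniqueness on the laminar line of a single-mode force -/

/-- **Uniqueness on the laminar line.** For `ν > 0`, `k ≠ 0`, `⟪k, v⟫ = 0`: EVERY global Leray–Hopf
solution with force `F = stokesMode k v c` and datum `a₀ • F` is the laminar flow
`(A + (a₀ − A)e^{−λνt}) • F`, `λ = stokesEigenvalue k`, `A = (λν)⁻¹`, a.e. at every `t > 0`. [folklore] -/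
theorem ae_eq_laminar_of_isGlobalLerayHopf_mode (hk : k ≠ 0) (hkv : ⟪latticeVec k, v⟫_ℝ = 0) (c : Bool)
    {ν : ℝ} (hν : 0 < ν) {a₀ : ℝ} {u : ℝ → UnitAddTorus (Fin 3) → EuclideanSpace ℝ (Fin 3)}
    (hu : IsGlobalLerayHopf ν (fun _ => ⇑(stokesMode k v c)) (fun x => a₀ • stokesMode k v c x) u) :
    ∀ t : ℝ, 0 < t → u t =ᵐ[volume] fun x =>
      ((stokesEigenvalue k * ν)⁻¹ + (a₀ - (stokesEigenvalue k * ν)⁻¹) *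
        Real.exp (-(stokesEigenvalue k * ν * t))) • stokesMode k v c x := by
  have hc : 0 < stokesEigenvalue k * ν := mul_pos (stokesEigenvalue_pos hk) hν
  set r : ℝ := stokesEigenvalue k * ν with hr_def
  set A : ℝ := r⁻¹ with hA_def
  set a : ℝ → ℝ := fun s => A + (a₀ - A) * Real.exp (-(r * s)) with ha_def
  have hcl := isClassicalNSSolutionOn_ampMode hkv c a (contDiff_ampLine r A a₀) ν
  have hb : ∀ t, deriv a t + stokesEigenvalue k * ν * a t = 1 := fun t => by
    rw [← hr_def, ha_def, deriv_ampLine_add, hA_def, mul_inv_cancel₀ hc.ne']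
  have hf : (fun t (x : UnitAddTorus (Fin 3)) => (deriv a t + stokesEigenvalue k * ν * a t) • stokesMode k v c x) =
      fun _ => ⇑(stokesMode k v c) := by
    funext t x
    rw [hb t, one_smul]
  rw [hf] at hcl
  have h0 : (fun t (x : UnitAddTorus (Fin 3)) => a t • stokesMode k v c x) 0 = fun x => a₀ • stokesMode k v c x := by
    funext x
    show a 0 • stokesMode k v c x = a₀ • stokesMode k v c x
    rw [ha_def]
    simp
  have hu' : IsGlobalLerayHopf ν (fun _ => ⇑(stokesMode k v c))
      ((fun t (x : UnitAddTorus (Fin 3)) => a t • stokesMode k v c x) 0) u := by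
    rw [h0]
    exact hu
  intro t ht
  exact hu'.ae_eq_of_isClassicalNSSolutionOn_univ_forced hcl hν.le t ht

/-! ## 3. Mean energy on the laminar line -/

/-- `∫ ‖stokesMode k a c‖² = ‖a‖²/2` for `k ≠ 0`. [folklore] -/
private theorem integral_norm_sq_stokesMode' (hk : k ≠ 0) (a : EuclideanSpace ℝ (Fin 3)) (c : Bool) :
    ∫ x, ‖stokesMode k a c x‖ ^ 2 = ‖a‖ ^ 2 / 2 := by
  rw [← inner_stokesModeL2_self hk a c, real_inner_self_eq_norm_sq, ← integral_norm_sq_coe_eq]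
  refine integral_congr_ae ?_
  filter_upwards [coeFn_stokesModeL2 k a c] with x hx
  rw [hx]

/-- `∫ ‖r • F‖² = (‖v‖²/2) r²`. [folklore] -/
theorem integral_norm_sq_ampMode (hk : k ≠ 0) (c : Bool) (r : ℝ) :
    ∫ x, ‖r • stokesMode k v c x‖ ^ 2 = ‖v‖ ^ 2 / 2 * r ^ 2 := by
  simp_rw [norm_smul, mul_pow, integral_const_mul, integral_norm_sq_stokesMode' hk, Real.norm_eq_abs, sq_abs]
  ring

/-- **Mean energy of any solution on the laminar line = that of the laminar flow, `≥ ‖v‖²/(16λ²ν²)`.** [folklore] -/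
theorem le_meanEnergy_of_isGlobalLerayHopf_mode (hk : k ≠ 0) (hkv : ⟪latticeVec k, v⟫_ℝ = 0) (c : Bool)
    {ν : ℝ} (hν : 0 < ν) {a₀ : ℝ} {u : ℝ → UnitAddTorus (Fin 3) → EuclideanSpace ℝ (Fin 3)}
    (hu : IsGlobalLerayHopf ν (fun _ => ⇑(stokesMode k v c)) (fun x => a₀ • stokesMode k v c x) u) :
    ‖v‖ ^ 2 / (16 * (stokesEigenvalue k) ^ 2 * ν ^ 2) ≤ meanEnergy u := by
  have hc : 0 < stokesEigenvalue k * ν := mul_pos (stokesEigenvalue_pos hk) hν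
  have hE : meanEnergy u = meanEnergy (fun t (x : UnitAddTorus (Fin 3)) =>
      ((stokesEigenvalue k * ν)⁻¹ + (a₀ - (stokesEigenvalue k * ν)⁻¹) *
        Real.exp (-(stokesEigenvalue k * ν * t))) • stokesMode k v c x) := by
    rw [meanEnergy_eq_longTimeAvgSup, meanEnergy_eq_longTimeAvgSup]
    refine longTimeAvgSup_congr_of_eqOn_Ioi fun t ht => integral_congr_ae ?_
    filter_upwards [ae_eq_laminar_of_isGlobalLerayHopf_mode hk hkv c hν hu t ht] with x hx
    rw [hx]
  rw [hE, meanEnergy_eq_longTimeAvgSup]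
  simp_rw [integral_norm_sq_ampMode hk]
  have h := longTimeAvgSup_ampLine_sq_ge (a₀ := a₀) (A := (stokesEigenvalue k * ν)⁻¹) hc
    (by positivity : (0 : ℝ) ≤ ‖v‖ ^ 2 / 2)
  refine le_trans (le_of_eq ?_) h
  have h1 : stokesEigenvalue k ≠ 0 := (stokesEigenvalue_pos hk).ne'
  have h2 : ν ≠ 0 := hν.ne'
  field_simp
  ring

/-! ## 4. Consequences: no bounded-energy vanishing-viscosity family on any laminar line -/

/-- **No vanishing-viscosity family on the laminar line of a single-mode force has bounded mean
energy** (`v ≠ 0`; data `α j • F`; ANY solutions `u_j`: `⟨‖u_j‖²⟩ ≥ ‖v‖²/(16λ²ν_j²) → ∞`). [folklore] -/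
theorem not_boundedEnergy_family_mode (hk : k ≠ 0) (hkv : ⟪latticeVec k, v⟫_ℝ = 0) (hv : v ≠ 0) (c : Bool) :
    ¬ ∃ (ν : ℕ → ℝ) (α : ℕ → ℝ) (u : ℕ → ℝ → UnitAddTorus (Fin 3) → EuclideanSpace ℝ (Fin 3)),
        (∀ j, 0 < ν j) ∧ Tendsto ν atTop (𝓝 0) ∧
        (∀ j, IsGlobalLerayHopf (ν j) (fun _ => ⇑(stokesMode k v c)) (fun x => α j • stokesMode k v c x) (u j)) ∧
        ∃ E : ℝ, ∀ j, meanEnergy (u j) ≤ E := by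
  rintro ⟨ν, α, u, hν, hν0, hu, E, hE⟩
  have hvn : 0 < ‖v‖ := norm_pos_iff.2 hv
  have hlam : 0 < stokesEigenvalue k := stokesEigenvalue_pos hk
  set κ : ℝ := ‖v‖ ^ 2 / (16 * (stokesEigenvalue k) ^ 2) with hκ
  have hκ0 : 0 < κ := by positivity
  have hE1 : 0 < |E| + 1 := by positivity
  set δ : ℝ := min 1 (κ / (|E| + 1)) with hδ
  have hδ0 : 0 < δ := lt_min one_pos (by positivity)
  have hev : ∀ᶠ j in atTop, ν j < δ := (tendsto_order.1 hν0).2 δ hδ0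
  obtain ⟨j, hj⟩ := hev.exists
  have hνj := hν j
  have hνj1 : ν j < 1 := hj.trans_le (min_le_left _ _)
  have hνjδ : ν j < κ / (|E| + 1) := hj.trans_le (min_le_right _ _)
  have hlow := le_meanEnergy_of_isGlobalLerayHopf_mode hk hkv c hνj (hu j)
  have hEj := hE j
  have hrew : ‖v‖ ^ 2 / (16 * (stokesEigenvalue k) ^ 2 * ν j ^ 2) = κ / ν j ^ 2 := by
    rw [hκ, div_div]
  rw [hrew] at hlow
  have h1 : |E| + 1 < κ / ν j := by
    rw [lt_div_iff₀ hνj]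
    rw [lt_div_iff₀ hE1] at hνjδ
    linarith
  have h2 : κ / ν j ≤ κ / ν j ^ 2 := by
    refine div_le_div_of_nonneg_left hκ0.le (by positivity) ?_
    nlinarith
  have h3 : E ≤ |E| := le_abs_self E
  linarith

/-- **The summit's shape is FALSE on every laminar line of every single-mode force** (`k ≠ 0`,
`⟪k, v⟫ = 0`, `v ≠ 0`; data `α j • F`; any admissible `u_j`): already the energy clause fails
(`not_boundedEnergy_family_mode`). [folklore] -/
theorem not_zerothLaw_shape_mode (hk : k ≠ 0) (hkv : ⟪latticeVec k, v⟫_ℝ = 0) (hv : v ≠ 0) (c : Bool) :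
    ¬ ∃ (ν : ℕ → ℝ) (α : ℕ → ℝ) (u : ℕ → ℝ → UnitAddTorus (Fin 3) → EuclideanSpace ℝ (Fin 3)),
        (∀ j, 0 < ν j) ∧ Tendsto ν atTop (𝓝 0) ∧
        (∀ j, IsGlobalLerayHopf (ν j) (fun _ => ⇑(stokesMode k v c)) (fun x => α j • stokesMode k v c x) (u j)) ∧
        (∃ E : ℝ, ∀ j, meanEnergy (u j) ≤ E) ∧
        ∃ ε : ℝ, 0 < ε ∧ ∀ j, ε ≤ meanDissipation (ν j) (u j) := by
  rintro ⟨ν, α, u, hν, hν0, hu, hE, -⟩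
  exact not_boundedEnergy_family_mode hk hkv hv c ⟨ν, α, u, hν, hν0, hu, hE⟩

/-- **Rest specialisation** (`α ≡ 0`): no vanishing-viscosity family FROM REST under a single-mode force
`stokesMode k v c` (`k ≠ 0`, `⟪k, v⟫ = 0`, `v ≠ 0`) realises the summit's shape. [folklore] -/
theorem not_zerothLaw_shape_mode_rest (hk : k ≠ 0) (hkv : ⟪latticeVec k, v⟫_ℝ = 0) (hv : v ≠ 0) (c : Bool) :
    ¬ ∃ (ν : ℕ → ℝ) (u : ℕ → ℝ → UnitAddTorus (Fin 3) → EuclideanSpace ℝ (Fin 3)),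
        (∀ j, 0 < ν j) ∧ Tendsto ν atTop (𝓝 0) ∧
        (∀ j, IsGlobalLerayHopf (ν j) (fun _ => ⇑(stokesMode k v c)) 0 (u j)) ∧
        (∃ E : ℝ, ∀ j, meanEnergy (u j) ≤ E) ∧
        ∃ ε : ℝ, 0 < ε ∧ ∀ j, ε ≤ meanDissipation (ν j) (u j) := by
  have h0 : (fun x : UnitAddTorus (Fin 3) => (0 : ℝ) • stokesMode k v c x) = 0 := by
    funext x
    rw [zero_smul, Pi.zero_apply]
  rintro ⟨ν, u, hν, hν0, hu, hE, hε⟩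
  refine not_zerothLaw_shape_mode hk hkv hv c ⟨ν, fun _ => 0, u, hν, hν0, fun j => ?_, hE, hε⟩
  rw [h0]
  exact hu j

/-- **The Kolmogorov force of `SymmetricOrLoud` / `ClassTrim` / `CoherentFraction`**,
`f = stokesMode (0,2,0) e₀ sin = sin(4πx₁)e₀`: from rest (and from every datum on its laminar line)
no vanishing-viscosity family of Leray–Hopf solutions realises the summit's shape. [folklore] -/
theorem not_zerothLaw_shape_kolmogorov_rest :
    ¬ ∃ (ν : ℕ → ℝ) (u : ℕ → ℝ → UnitAddTorus (Fin 3) → EuclideanSpace ℝ (Fin 3)),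
        (∀ j, 0 < ν j) ∧ Tendsto ν atTop (𝓝 0) ∧
        (∀ j, IsGlobalLerayHopf (ν j)
          (fun _ => ⇑(stokesMode (![0, 2, 0] : Fin 3 → ℤ) (EuclideanSpace.single (0 : Fin 3) (1 : ℝ)) false)) 0 (u j)) ∧
        (∃ E : ℝ, ∀ j, meanEnergy (u j) ≤ E) ∧
        ∃ ε : ℝ, 0 < ε ∧ ∀ j, ε ≤ meanDissipation (ν j) (u j) := by
  refine not_zerothLaw_shape_mode_rest ?_ ?_ ?_ false
  · intro h
    have := congr_fun h 1
    simp at this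
  · rw [EuclideanSpace.inner_single_right, latticeVec_apply]
    simp
  · intro h
    have := congr_arg (fun w : EuclideanSpace ℝ (Fin 3) => w 0) h
    simp at this

end Summit.AnomalousDissipation.AnomalousDissipation.Theorems.RestMeanFloorTG.Negative

end
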